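import Summits.CriticalPhenomena.CardyFormulaZ2.Theorems.CardyBoundaryCoulombGasBoundaryDefectGaussianRStubRigidityOfLocalLawsPart6

/-!
# Stub `stub_realisability` of line `rainbow-monomials-in-excursion-kernels` — Part 8:
# the level profile of the collar walk of an ADMISSIBLE leg insertion
# (crux `BoundaryDefectGaussianR`, stmt-CriticalPhenomena-14132; insertion dictionary D2)

Semantics (E) of the jump collar `LegInsertionData.collar` (Parts (A)–(D): Part 7). For admissible
`ι` on `V` with sink dart `d₀` (`outDart V ι.sink = some d₀`), `ds = cycle V d₀`, `P = ds.length`,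
`L = ι.sinkLegs`, and `st t` the walk state after `t` darts (hypothesis `hst`, discharged by
`fun _ ↦ rfl`):

* `st 0 = ι.init = ⟨-L, L odd, 0, 0⟩`, `0 < P`, `1 ≤ L` (`sinkLegs_pos`), and the walk closes up:
  `st P` has level `-L`, wiredness `L odd`, nothing pending (`st_final`);
* the sink's dart (dart `0`) is the junction `-L → -L + 1` closing the initial wired stretch (`L`
  odd) or the jump edge `-L → -L + 2` (`L` even); after it: free, sign `+1` (`st_one`);
* parity: `(st t).wired ↔ (st t).level` odd (`st_wired_iff_odd`, from `invariant_foldl`);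
* signs: while legs are pending the sign is `±1` (`st_sgn`);
* the POTENTIAL `(st t).level + sgn · pending` (the level reached once the pending legs are
  realised) is `0` after the sink's dart and non-increasing afterwards (each source met lowers it by
  its leg number, silent darts keep it), whence in `[-L, 0]` (`st_potential_one`,
  `st_potential_antitone`, `st_potential_mem`);
* the LEVELS lie in `[-L, 0]` (`st_level_mem`: each dart moves the level towards the potential
  without overshooting, `level_step_between`);
* the STEP TRICHOTOMY (`st_step_cases`, from `step_cases`): dart `t` is silent (level and wiredness
  kept), a JUNCTION (level `± 1 = + sgn`, wiredness flips) or a JUMP EDGE (level `± 2 = + 2 sgn`,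
  free before and after), with `sgn = +1` (sink legs pending: the level rises) or `-1` (source).

Registered sub-goal carried here: `s12_collarLevels`. Unit tests (exact evaluation on the 4×2 box,
see Part 7): `(2;2)`: levels `-2 |0| 0 … 0 |11| -2` (two jump edges); `(1;1)`: `-1(w) |0| 0 … 0
|11| -1(w)` (two junctions); `(1,1;2)`: `-2 |0| 0 … |5| -1(w) … |11| -2` (jump, junction, junction).
-/

namespace Summit.CriticalPhenomena.CardyFormulaZ2.Cruxes.BoundaryDefectGaussianR.RainbowMonomialsInExcursionKernels

open Literature.Probability.LatticeModels Literature.Probability.LatticeModels.CollarLegModel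

/-! ### One dart -/

/-- Insertion signs are `+1` (sink) or `-1` (source). [folklore] -/
theorem startAt_sgn (ι : LegInsertionData) (V : Finset (ℤ × ℤ)) (d : Dart) (L : ℕ) (σ : ℤ)
    (h : ι.startAt V d = some (L, σ)) : σ = 1 ∨ σ = -1 := by
  unfold LegInsertionData.startAt at h
  split_ifs at h with h1 h2
  · simp only [Option.some.injEq, Prod.mk.injEq] at h; omega
  · simp only [Option.some.injEq, Prod.mk.injEq] at h; omega

/-- **Step trichotomy with signs.** If the sign is `±1` while legs are pending (and insertion signs
are `±1`), then after the dart the same holds, and the dart is SILENT (level and wiredness kept), a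
JUNCTION (level `+ sgn`, wiredness flips) or a JUMP EDGE (level `+ 2 sgn`, free before and after),
with `sgn = ±1` the sign after the dart. [folklore] -/
theorem step_cases (s : WalkState) (o : Option (ℕ × ℤ)) (hs : s.pending = 0 ∨ s.sgn = 1 ∨ s.sgn = -1)
    (ho : ∀ L σ, o = some (L, σ) → σ = 1 ∨ σ = -1) :
    ((s.step o).pending = 0 ∨ (s.step o).sgn = 1 ∨ (s.step o).sgn = -1) ∧
    (((s.step o).level = s.level ∧ (s.step o).wired = s.wired) ∨
      (((s.step o).sgn = 1 ∨ (s.step o).sgn = -1) ∧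
        (((s.step o).level = s.level + (s.step o).sgn ∧ (s.step o).wired = !s.wired) ∨
          ((s.step o).level = s.level + 2 * (s.step o).sgn ∧ s.wired = false ∧
            (s.step o).wired = false)))) := by
  rcases o with _ | ⟨L, σ⟩
  · simp only [WalkState.step]
    split_ifs with h1 h2 h3
    · exact ⟨Or.inl h1, Or.inl ⟨rfl, rfl⟩⟩
    · have hσ : s.sgn = 1 ∨ s.sgn = -1 := hs.resolve_left h1
      exact ⟨Or.inr hσ, Or.inr ⟨hσ, Or.inl ⟨rfl, by simp [h2]⟩⟩⟩
    · have hσ : s.sgn = 1 ∨ s.sgn = -1 := hs.resolve_left h1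
      exact ⟨Or.inr hσ, Or.inr ⟨hσ, Or.inr ⟨rfl, by simpa using h2, by simpa using h2⟩⟩⟩
    · have hσ : s.sgn = 1 ∨ s.sgn = -1 := hs.resolve_left h1
      exact ⟨Or.inr hσ, Or.inr ⟨hσ, Or.inl ⟨rfl, by simp [Bool.eq_false_iff.2 h2]⟩⟩⟩
  · have hσ := ho L σ rfl
    simp only [WalkState.step]
    split_ifs with h1 h2 h3
    · exact ⟨Or.inl h1, Or.inl ⟨rfl, rfl⟩⟩
    · exact ⟨Or.inr hσ, Or.inr ⟨hσ, Or.inl ⟨rfl, by simp [h2]⟩⟩⟩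
    · exact ⟨Or.inr hσ, Or.inr ⟨hσ, Or.inr ⟨rfl, by simpa using h2, by simpa using h2⟩⟩⟩
    · exact ⟨Or.inr hσ, Or.inr ⟨hσ, Or.inl ⟨rfl, by simp [Bool.eq_false_iff.2 h2]⟩⟩⟩

/-- **No overshoot.** A dart moves the level towards the new potential `level + sgn · pending`
(after the dart) without passing it: the new level lies between the old level and the new
potential. [folklore] -/
theorem level_step_between (s : WalkState) (o : Option (ℕ × ℤ))
    (hs : s.pending = 0 ∨ s.sgn = 1 ∨ s.sgn = -1) (ho : ∀ L σ, o = some (L, σ) → σ = 1 ∨ σ = -1) :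
    min s.level ((s.step o).level + (s.step o).sgn * (s.step o).pending) ≤ (s.step o).level ∧
      (s.step o).level ≤ max s.level ((s.step o).level + (s.step o).sgn * (s.step o).pending) := by
  rcases o with _ | ⟨L, σ⟩
  · simp only [WalkState.step]
    split_ifs with h1 h2 h3
    · simp [h1]
    · have hσ : s.sgn = 1 ∨ s.sgn = -1 := hs.resolve_left h1
      dsimp only
      rcases hσ with h | h <;> · rw [h]; omega
    · have hσ : s.sgn = 1 ∨ s.sgn = -1 := hs.resolve_left h1
      dsimp only
      rcases hσ with h | h <;> · rw [h]; push_cast [h3]; omega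
    · have hσ : s.sgn = 1 ∨ s.sgn = -1 := hs.resolve_left h1
      have hp : s.pending = 1 := by omega
      dsimp only
      rcases hσ with h | h <;> · rw [h, hp]; simp
  · have hσ := ho L σ rfl
    simp only [WalkState.step]
    split_ifs with h1 h2 h3
    · dsimp only; simp [h1]
    · dsimp only
      rcases hσ with h | h <;> · subst h; omega
    · dsimp only
      rcases hσ with h | h <;> · subst h; push_cast [h3]; omega
    · have hp : L = 1 := by omega
      dsimp only
      rcases hσ with h | h <;> · subst h hp; simp

/-! ### Along the walk of an admissible datum -/

section Admissible

variable (ι : LegInsertionData) (V : Finset (ℤ × ℤ)) {d₀ : Dart} (hadm : ι.IsAdmissible V)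
  (h : outDart V ι.sink = some d₀) {st : ℕ → WalkState}
  (hst : ∀ t, st t = List.foldl (fun s d => s.step (ι.startAt V d)) ι.init ((cycle V d₀).take t))

include hst in
/-- The state after `t + 1` darts is the step of the state after `t` darts at dart `t`. [folklore] -/
theorem st_succ {t : ℕ} (ht : t < (cycle V d₀).length) :
    st (t + 1) = (st t).step (ι.startAt V (cycle V d₀)[t]) := by
  rw [hst, hst, foldl_take_succ (ι.startAt V) ι.init (cycle V d₀) ht]

include h in
/-- The sink's dart starts the sink's insertion `(L, +1)`. [folklore] -/
theorem startAt_sinkDart : ι.startAt V d₀ = some (ι.sinkLegs, 1) := by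
  unfold LegInsertionData.startAt
  rw [if_pos h]

include hadm h in
/-- The sink's dart of an admissible datum is an exterior dart. [folklore] -/
theorem sinkDart_exterior : d₀.1 ∈ V ∧ dartTip d₀ ∉ V := by
  obtain ⟨d, hd, -, hv, ht, -⟩ := s3_of_admissible ι V hadm
  obtain rfl : d = d₀ := Option.some.inj (hd.symm.trans h)
  exact ⟨hv, ht⟩

include hadm h in
/-- The boundary cycle of an admissible datum is non-empty (its length is the period). [folklore] -/
theorem length_cycle_pos : 0 < (cycle V d₀).length := by
  obtain ⟨hv, ht⟩ := sinkDart_exterior ι V hadm h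
  simpa [cycle] using (s3_period_spec V d₀ hv ht).1

include hadm h in
/-- The darts of the cycle after the first are not the sink's dart (minimality of the period), so
their contribution `σ L` to the potential is `≤ 0` (a source, or nothing). [folklore] -/
theorem contrib_nonpos {s : ℕ} (hs0 : 0 < s) (hs : s < (cycle V d₀).length) :
    (ι.startAt V (cycle V d₀)[s]).elim 0 (fun q => q.2 * (q.1 : ℤ)) ≤ 0 := by
  obtain ⟨hv, ht⟩ := sinkDart_exterior ι V hadm h
  have hne : (cycle V d₀)[s] ≠ d₀ := by
    have hget : (cycle V d₀)[s] = (dsucc V)^[s] d₀ := by simp [cycle]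
    rw [hget]
    exact (s3_period_spec V d₀ hv ht).2.2.2 s hs0 (by simpa [cycle] using hs)
  unfold LegInsertionData.startAt
  split_ifs with h1 h2
  · exact absurd (Option.some.inj (h.symm.trans h1)).symm hne
  · simp
  · simp

include hst in
/-- Signs: while legs are pending the sign is `±1`. [folklore] -/
theorem st_sgn : ∀ {t : ℕ}, t ≤ (cycle V d₀).length →
    (st t).pending = 0 ∨ (st t).sgn = 1 ∨ (st t).sgn = -1
  | 0, _ => Or.inl (by rw [hst]; rfl)
  | t + 1, ht => by
    rw [st_succ ι V hst (by omega)]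
    exact (step_cases _ _ (st_sgn (by omega)) fun L σ hL => startAt_sgn ι V _ L σ hL).1

include hadm in
/-- An admissible datum has at least one leg at the sink (`L = Σ Lᵢ ≥ 1`). [folklore] -/
theorem sinkLegs_pos : 1 ≤ ι.sinkLegs := by
  obtain ⟨⟨x, hx⟩, hlegs, -⟩ := hadm
  exact le_trans (hlegs x hx) (Finset.single_le_sum (fun _ _ => Nat.zero_le _) hx)

include hadm h hst

/-- Admissibility, clause 5, by position: an insertion starts with nothing pending. [folklore] -/
theorem st_pending_of_startAt {s : ℕ} (hs : s < (cycle V d₀).length)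
    (hstart : ι.startAt V (cycle V d₀)[s] ≠ none) : (st s).pending = 0 := by
  rw [hst]
  exact hadm.2.2.2.2.1 _ ((mem_walk_iff ι V h).2 ⟨s, hs, rfl⟩) hstart

/-- **The walk closes up** (admissibility, last clause): after all `P` darts the level is `-L`, the
stretch is wired iff `L` is odd, nothing is pending. [folklore] -/
theorem st_final : (st (cycle V d₀).length).level = -(ι.sinkLegs : ℤ) ∧
    (st (cycle V d₀).length).wired = (ι.sinkLegs % 2 == 1) ∧
    (st (cycle V d₀).length).pending = 0 := by
  have hlast := hadm.2.2.2.2.2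
  rw [getLast?_walk ι V h (length_cycle_pos ι V hadm h), Option.map_some, Option.some.injEq,
    Prod.mk.injEq, Prod.mk.injEq] at hlast
  rw [hst, List.take_length]
  exact hlast

/-- **The sink's dart** (dart `0`) is never silent: it is the junction closing the wired stretch
before the sink (`L` odd: level `-L → -L + 1`) or a jump edge (`L` even: `-L → -L + 2`); after it
the stretch is free, the sign is `+1` and `L - 1`, resp. `L - 2`, sink legs are pending. [folklore] -/
theorem st_one : (st 1).sgn = 1 ∧ (st 1).wired = false ∧
    (st 1).level = -(ι.sinkLegs : ℤ) + 2 - (ι.sinkLegs % 2 : ℕ) ∧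
    ((st 1).pending : ℤ) = (ι.sinkLegs : ℤ) - 2 + (ι.sinkLegs % 2 : ℕ) := by
  have hP := length_cycle_pos ι V hadm h
  have hL := sinkLegs_pos ι V hadm
  have h0 : (cycle V d₀)[0] = d₀ := by simp [cycle]
  rw [st_succ ι V hst (t := 0) hP, hst, List.take_zero, List.foldl_nil, h0, startAt_sinkDart ι V h]
  simp only [WalkState.step, LegInsertionData.init]
  split_ifs with h1 h2 h3
  · exact absurd h1 (by omega)
  · simp only [beq_iff_eq] at h2
    refine ⟨rfl, rfl, ?_, ?_⟩ <;> push_cast [h2] <;> omega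
  · simp only [beq_iff_eq] at h2
    have h2' : ι.sinkLegs % 2 = 0 := by omega
    refine ⟨rfl, by simpa using h2, ?_, ?_⟩ <;> push_cast [h2'] <;> omega
  · simp only [beq_iff_eq] at h2
    exact absurd h3 (by omega)

/-- **Parity and potential along the walk** (`invariant_foldl` instantiated): the stretch after `t`
darts is wired iff its level is odd, and the potential after `t` darts is `-L` plus the contributions
`σ L` of the insertions met. [folklore] -/
theorem st_invariant {t : ℕ} (ht : t ≤ (cycle V d₀).length) :
    ((st t).wired = true ↔ (st t).level % 2 = 1) ∧
    (st t).level + (st t).sgn * (st t).pending = -(ι.sinkLegs : ℤ) +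
      (((cycle V d₀).take t).map fun d => (ι.startAt V d).elim 0 fun q => q.2 * (q.1 : ℤ)).sum := by
  have hw₀ : ι.init.wired = true ↔ ι.init.level % 2 = 1 := by
    simp only [LegInsertionData.init, beq_iff_eq]; omega
  have hodd : ∀ d L σ, ι.startAt V d = some (L, σ) → σ % 2 = 1 := by
    intro d L σ hd; rcases startAt_sgn ι V d L σ hd with rfl | rfl <;> decide
  obtain ⟨hw, -, hpot⟩ := invariant_foldl (ι.startAt V) ι.init hw₀ (Or.inl rfl) hodd (cycle V d₀) t ht
    fun s hs hne => by simpa [hst] using st_pending_of_startAt ι V hadm h hst (by omega) hne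
  rw [hst]
  refine ⟨hw, ?_⟩
  rw [hpot]
  simp [LegInsertionData.init]

/-- Parity: wired iff the level is odd. [folklore] -/
theorem st_wired_iff_odd {t : ℕ} (ht : t ≤ (cycle V d₀).length) :
    (st t).wired = true ↔ (st t).level % 2 = 1 :=
  (st_invariant ι V hadm h hst ht).1

/-- The potential after the sink's dart is `0` (`-L + L`). [folklore] -/
theorem st_potential_one : (st 1).level + (st 1).sgn * (st 1).pending = 0 := by
  have hP := length_cycle_pos ι V hadm h
  rw [(st_invariant ι V hadm h hst hP).2, List.take_succ_eq_append_getElem hP]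
  have h0 : (cycle V d₀)[0] = d₀ := by simp [cycle]
  simp [h0, startAt_sinkDart ι V h]

/-- The potential is non-increasing after the sink's dart (sources lower it, silent darts keep
it). [folklore] -/
theorem st_potential_antitone {t t' : ℕ} (h1 : 1 ≤ t) (htt' : t ≤ t')
    (ht' : t' ≤ (cycle V d₀).length) :
    (st t').level + (st t').sgn * (st t').pending ≤ (st t).level + (st t).sgn * (st t).pending := by
  induction t', htt' using Nat.le_induction with
  | base => exact le_rfl
  | succ t' htt' ih =>
    refine le_trans ?_ (ih (by omega))
    rw [(st_invariant ι V hadm h hst ht').2, (st_invariant ι V hadm h hst (by omega : t' ≤ _)).2,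
      List.take_succ_eq_append_getElem (by omega), List.map_append, List.sum_append]
    have := contrib_nonpos ι V hadm h (s := t') (by omega) (by omega)
    simp only [List.map_cons, List.map_nil, List.sum_cons, List.sum_nil, add_zero]
    linarith

/-- **The potential lies in `[-L, 0]`.** [folklore] -/
theorem st_potential_mem {t : ℕ} (ht : t ≤ (cycle V d₀).length) :
    -(ι.sinkLegs : ℤ) ≤ (st t).level + (st t).sgn * (st t).pending ∧
      (st t).level + (st t).sgn * (st t).pending ≤ 0 := by
  rcases Nat.eq_zero_or_pos t with rfl | ht0
  · rw [hst]; simp [LegInsertionData.init]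
  have hP := length_cycle_pos ι V hadm h
  obtain ⟨hl, -, hp⟩ := st_final ι V hadm h hst
  constructor
  · have := st_potential_antitone ι V hadm h hst ht0 ht le_rfl
    rw [hl, hp] at this
    simpa using this
  · have := st_potential_antitone ι V hadm h hst le_rfl ht0 ht
    rwa [st_potential_one ι V hadm h hst] at this

/-- **The levels lie in `[-L, 0]`** (lowest just before the sink, `0` on the stretch between the
sink's footprint and the first source). [folklore] -/
theorem st_level_mem : ∀ {t : ℕ}, t ≤ (cycle V d₀).length →
    -(ι.sinkLegs : ℤ) ≤ (st t).level ∧ (st t).level ≤ 0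
  | 0, _ => by rw [hst]; simp [LegInsertionData.init]
  | t + 1, ht => by
    have ih := st_level_mem (t := t) (by omega)
    have hpot := st_potential_mem ι V hadm h hst ht
    have hb := level_step_between (st t) (ι.startAt V (cycle V d₀)[t]) (st_sgn ι V hst (by omega))
      fun L σ hL => startAt_sgn ι V _ L σ hL
    rw [st_succ ι V hst (t := t) (by omega)] at hpot ⊢
    constructor
    · exact le_trans (le_min ih.1 hpot.1) hb.1
    · exact le_trans hb.2 (max_le ih.2 hpot.2)

omit hadm h in
/-- **Step trichotomy along the walk**: dart `t` is silent, a junction (`± 1`, wiredness flips) or a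
jump edge (`± 2`, free before and after), the sign being that of the pending insertion. [folklore] -/
theorem st_step_cases {t : ℕ} (ht : t < (cycle V d₀).length) :
    ((st (t + 1)).level = (st t).level ∧ (st (t + 1)).wired = (st t).wired) ∨
      (((st (t + 1)).sgn = 1 ∨ (st (t + 1)).sgn = -1) ∧
        (((st (t + 1)).level = (st t).level + (st (t + 1)).sgn ∧ (st (t + 1)).wired = !(st t).wired) ∨
          ((st (t + 1)).level = (st t).level + 2 * (st (t + 1)).sgn ∧ (st t).wired = false ∧
            (st (t + 1)).wired = false))) := by
  rw [st_succ ι V hst ht]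
  exact (step_cases _ _ (st_sgn ι V hst ht.le) fun L σ hL => startAt_sgn ι V _ L σ hL).2

end Admissible

/-! ### Registered one-line form -/

/-- **Sub-goal `s12_collarLevels`** (registered on stmt-CriticalPhenomena-14132): semantics (E) of
the jump collar — the level profile of the collar walk of an ADMISSIBLE leg insertion: `0 < P`,
`st 0 = init`, the walk closes up (`st P`: level `-L`, wired iff `L` odd, nothing pending); for all
`t ≤ P`: wired iff level odd, level and potential in `[-L, 0]`, sign `±1` while legs are pending;
potential `0` after the sink's dart and non-increasing afterwards; and for `t < P` the step
trichotomy silent / junction (`+ sgn`, wiredness flips) / jump edge (`+ 2 sgn`, free both sides),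
`sgn = ±1`. [folklore] -/
theorem s12_collarLevels : ∀ (ι : Literature.Probability.LatticeModels.CollarLegModel.LegInsertionData) (V : Finset (ℤ × ℤ)) (d₀ : Literature.Probability.LatticeModels.CollarLegModel.Dart) (st : ℕ → Literature.Probability.LatticeModels.CollarLegModel.WalkState), ι.IsAdmissible V → Literature.Probability.LatticeModels.CollarLegModel.outDart V ι.sink = some d₀ → (∀ t, st t = List.foldl (fun s d ↦ s.step (ι.startAt V d)) ι.init ((Literature.Probability.LatticeModels.CollarLegModel.cycle V d₀).take t)) → 0 < (Literature.Probability.LatticeModels.CollarLegModel.cycle V d₀).length ∧ st 0 = ι.init ∧ ((st (Literature.Probability.LatticeModels.CollarLegModel.cycle V d₀).length).level = -(ι.sinkLegs : ℤ) ∧ (st (Literature.Probability.LatticeModels.CollarLegModel.cycle V d₀).length).wired = (ι.sinkLegs % 2 == 1) ∧ (st (Literature.Probability.LatticeModels.CollarLegModel.cycle V d₀).length).pending = 0) ∧ (∀ t, t ≤ (Literature.Probability.LatticeModels.CollarLegModel.cycle V d₀).length → ((st t).wired = true ↔ (st t).level % 2 = 1) ∧ (-(ι.sinkLegs : ℤ)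 ≤ (st t).level ∧ (st t).level ≤ 0) ∧ (-(ι.sinkLegs : ℤ) ≤ (st t).level + (st t).sgn * (st t).pending ∧ (st t).level + (st t).sgn * (st t).pending ≤ 0) ∧ ((st t).pending = 0 ∨ (st t).sgn = 1 ∨ (st t).sgn = -1)) ∧ (st 1).level + (st 1).sgn * (st 1).pending = 0 ∧ (∀ t t', 1 ≤ t → t ≤ t' → t' ≤ (Literature.Probability.LatticeModels.CollarLegModel.cycle V d₀).length → (st t').level + (st t').sgn * (st t').pending ≤ (st t).level + (st t).sgn * (st t).pending) ∧ (∀ t, t < (Literature.Probability.LatticeModels.CollarLegModel.cycle V d₀).length → ((st (t + 1)).level = (st t).level ∧ (st (t + 1)).wired = (st t).wired) ∨ (((st (t + 1)).sgn = 1 ∨ (st (t + 1)).sgn = -1) ∧ (((st (t + 1)).level = (st t).level + (st (t + 1)).sgn ∧ (st (t + 1)).wired = !(st t).wired) ∨ ((st (t + 1)).level = (st t).level + 2 * (st (t + 1)).sgn ∧ (st t).wired = false ∧ (st (t + 1)).wired = false)))) :=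
  fun ι V _ _ hadm h hst => ⟨length_cycle_pos ι V hadm h, by rw [hst]; rfl, st_final ι V hadm h hst,
    fun _ ht => ⟨st_wired_iff_odd ι V hadm h hst ht, st_level_mem ι V hadm h hst ht,
      st_potential_mem ι V hadm h hst ht, st_sgn ι V hst ht⟩,
    st_potential_one ι V hadm h hst,
    fun _ _ h1 htt' ht' => st_potential_antitone ι V hadm h hst h1 htt' ht',
    fun _ ht => st_step_cases ι V hst ht⟩

end Summit.CriticalPhenomena.CardyFormulaZ2.Cruxes.BoundaryDefectGaussianR.RainbowMonomialsInExcursionKernels
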